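import Literature.AlgebraicGeometry.Frobenioids.BirationalizationCategory
import Literature.AlgebraicGeometry.Frobenioids.BiratUnitsDiv
import Literature.AlgebraicGeometry.Frobenioids.ModelFrobenioidFunctor
import Literature.AlgebraicGeometry.Frobenioids.BiratGerms
import HarnessLib

/-!
# Frobenioids I, Proposition 4.4 (i): the functor `C^birat → F_{Φ^gp}` (part 3)

Mochizuki, *The geometry of Frobenioids I: the general theory*, Kyushu J. Math. **62** (2008)
293–400, §4, Proposition 4.4 (i), kurims text pp. 83–84 [cite: MochizukiFrdI2008, Prop. 4.4(i)
p.83]: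
"Moreover, there exists a natural 1-commutative diagram of functors `C → F_Φ` / `C^birat → F_{Φ^gp}
→ F_{0_D}` where the functors between elementary Frobenioids are those induced by the natural
morphisms of monoids `Φ → Φ^gp → 0_D`"; proof (p. 84 l. 52): "by assigning to the pair
`(α : A′ → A, φ′ : A′ → B)` the element `Φ(α)⁻¹{Div(φ′) − deg_Fr(φ′) · Div(α)} ∈ Φ(A)^gp`
[cf. Remark 1.1.1] one verifies immediately that the functor `C → F_Φ` induces a functor
`C^birat → F_{Φ^gp}`".

Over parts 1–2 (`Birationalization.lean`, `BirationalizationCategory.lean`) this file defines, on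
birational fractions, the base map `Base(α)⁻¹ ≫ Base(φ′)`, the Frobenius degree `deg_Fr(φ′)` and the
`Φ^gp`-divisor `Φ(α)⁻¹{Div(φ′) − deg_Fr(φ′)·Div(α)}`, proves that they are constant on colimit
classes
and satisfy the laws of Remark 1.1.1 with respect to composition by squares, and assembles THE
functor
`Birat.toElemGp : C^birat → F_{Φ^gp}` together with the base functor `C^birat → D` and the
1-commutativity `C → C^birat → F_{Φ^gp}` = `C → F_Φ → F_{Φ^gp}` (on the nose).  `Φ^gp` on `D` is
seat
L1-t2's `monoidGp Φ` (Thm. 5.2 (i) file), so that `pull (monoidGp Φ) f = pullGp Φ f`.  Hypothesis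
`hsq : HasBiratSquares F` (Prop. 1.11 (vii)) as in parts 1–2.  Not here: the factorization through
`F_{Φ^birat}` (Prop. 4.4 (iii): `Φ^birat` is seat L1-t5's `biratSubfunctor`; bridge owed) and the
Frobenioid axioms for `C^birat → F_{0_D}` ((ii), "a routine exercise").
-/

namespace Literature.AlgebraicGeometry.Frobenioids

open CategoryTheory Opposite

universe w v v' u u'

namespace PreFrobenioid

variable {D : Type u} [Category.{v} D] {Φ : Dᵒᵖ ⥤ CommMonCat.{w}}
  {C : Type u'} [Category.{v'} C] {F : C ⥤ ElemFrobenioid Φ} {hF : IsFrobenioid F}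
  {hsq : HasBiratSquares F}

/-- `pull (Φ^gp) f` is the groupification of `pull Φ f` (seat L1-t2's `pullGp`).
[cite: MochizukiFrdI2008, Def. 1.1(ii)] -/
theorem pull_monoidGp {X Y : D} (f : X ⟶ Y) (c : Algebra.GrothendieckGroup (Φ.obj (op Y))) :
    pull (monoidGp Φ) f c = pullGp Φ f c := rfl

namespace BiratFrac

variable {A B B' : C}

/-! ### Base, Frobenius degree and `Φ^gp`-divisor of a birational fraction -/

/-- The base map of `(α, φ′)`: `Base(α)⁻¹ ≫ Base(φ′) : Base A → Base B`.
[cite: MochizukiFrdI2008, Prop. 4.4(i) p.84] -/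
noncomputable def base (f : BiratFrac F A B) : baseObj F A ⟶ baseObj F B :=
  haveI : IsIso (Base F f.den) := f.den_mem.2.2
  inv (Base F f.den) ≫ Base F f.num

/-- The Frobenius degree of `(α, φ′)`: `deg_Fr(φ′)` (morphisms of a given Frobenius degree are
preserved, Prop. 4.4 (iv)). [cite: MochizukiFrdI2008, Prop. 4.4(i) p.84] -/
def deg (f : BiratFrac F A B) : ℕ+ := degFr F f.num

/-- The `Φ^gp`-divisor of `(α, φ′)`: `Φ(α)⁻¹{Div(φ′) − deg_Fr(φ′) · Div(α)} ∈ Φ(A)^gp` (p. 84 l.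
52),
multiplicatively. [cite: MochizukiFrdI2008, Prop. 4.4(i) p.84] -/
noncomputable def divGp (f : BiratFrac F A B) : PhiGp F A :=
  haveI : IsIso (Base F f.den) := f.den_mem.2.2
  pullGp Φ (inv (Base F f.den))
    (Algebra.GrothendieckGroup.of (Div F f.num) /
      Algebra.GrothendieckGroup.of (Div F f.den) ^ (deg f : ℕ))

/-- On the image `(id, φ)` of a morphism of `C`: base `= Base φ`. [cite: MochizukiFrdI2008, Prop.
4.4(i) p.83] -/
theorem base_ofHom (hF : IsFrobenioid F) (φ : A ⟶ B) : base (ofHom hF φ) = Base F φ := by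
  haveI : IsIso (Base F (𝟙 A)) := (isCoAngularPreStep_id hF A).2.2
  unfold base
  change inv (Base F (𝟙 A)) ≫ Base F φ = Base F φ
  simp only [base_id, IsIso.inv_id, Category.id_comp]

/-- On `(id, φ)`: degree `= deg_Fr φ`. [cite: MochizukiFrdI2008, Prop. 4.4(i) p.83] -/
theorem deg_ofHom (hF : IsFrobenioid F) (φ : A ⟶ B) : deg (ofHom hF φ) = degFr F φ := rfl

/-- Divisor of a fraction with identity denominator: `Div φ` in `Φ^gp`. [cite: MochizukiFrdI2008,
Prop. 4.4(i) p.83] -/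
theorem divGp_mk_id (φ : A ⟶ B) (h : IsCoAngularPreStep F (𝟙 A)) :
    divGp (⟨A, 𝟙 A, φ, h⟩ : BiratFrac F A B) = Algebra.GrothendieckGroup.of (Div F φ) := by
  haveI : IsIso (Base F (𝟙 A)) := h.2.2
  have hinv : inv (Base F (𝟙 A)) = 𝟙 _ :=
    IsIso.inv_eq_of_hom_inv_id (by rw [base_id, Category.comp_id])
  unfold divGp deg
  dsimp only
  rw [hinv, pullGp_id, div_id, map_one, one_pow, div_one]

/-- On `(id, φ)`: divisor `= Div φ` in `Φ^gp`. [cite: MochizukiFrdI2008, Prop. 4.4(i) p.83] -/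
theorem divGp_ofHom (hF : IsFrobenioid F) (φ : A ⟶ B) :
    divGp (ofHom hF φ) = Algebra.GrothendieckGroup.of (Div F φ) :=
  divGp_mk_id φ _

/-! ### Constancy on colimit classes -/

/-- The three invariants only depend on the arrows (congruence for literally equal data).
[cite: MochizukiFrdI2008, Prop. 4.4(i) p.84] -/
theorem eq_of_eq {E : C} {d d' : E ⟶ A} {n n' : E ⟶ B} (hd : d = d') (hn : n = n')
    (h : IsCoAngularPreStep F d) (h' : IsCoAngularPreStep F d') :
    base (⟨E, d, n, h⟩ : BiratFrac F A B) = base ⟨E, d', n', h'⟩ ∧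
      deg (⟨E, d, n, h⟩ : BiratFrac F A B) = deg ⟨E, d', n', h'⟩ ∧
      divGp (⟨E, d, n, h⟩ : BiratFrac F A B) = divGp ⟨E, d', n', h'⟩ := by
  subst hd hn
  exact ⟨rfl, rfl, rfl⟩

/-- Restriction along a co-angular pre-step `ε` does not change the base map.
[cite: MochizukiFrdI2008, Prop. 4.4(i) p.84] -/
theorem base_restrict (hF : IsFrobenioid F) (f : BiratFrac F A B) {E : C} (ε : E ⟶ f.src)
    (hε : IsCoAngularPreStep F ε) :
    base (⟨E, ε ≫ f.den, ε ≫ f.num, hε.comp hF f.den_mem⟩ : BiratFrac F A B) = base f := by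
  haveI : IsIso (Base F ε) := hε.2.2
  haveI : IsIso (Base F f.den) := f.den_mem.2.2
  haveI : IsIso (Base F (ε ≫ f.den)) := (hε.comp hF f.den_mem).2.2
  unfold base
  change inv (Base F (ε ≫ f.den)) ≫ Base F (ε ≫ f.num) = inv (Base F f.den) ≫ Base F f.num
  simp only [base_comp, IsIso.inv_comp, Category.assoc, IsIso.inv_hom_id_assoc]

/-- Restriction does not change the Frobenius degree. [cite: MochizukiFrdI2008, Prop. 4.4(i) p.84]
-/
theorem deg_restrict (hF : IsFrobenioid F) (f : BiratFrac F A B) {E : C} (ε : E ⟶ f.src)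
    (hε : IsCoAngularPreStep F ε) :
    deg (⟨E, ε ≫ f.den, ε ≫ f.num, hε.comp hF f.den_mem⟩ : BiratFrac F A B) = deg f := by
  change degFr F (ε ≫ f.num) = degFr F f.num
  rw [degFr_comp, hε.2.1, one_mul]

/-- Restriction does not change the `Φ^gp`-divisor (the terms in `Div ε` cancel).
[cite: MochizukiFrdI2008, Prop. 4.4(i) p.84] -/
theorem divGp_restrict (hF : IsFrobenioid F) (f : BiratFrac F A B) {E : C} (ε : E ⟶ f.src)
    (hε : IsCoAngularPreStep F ε) :
    divGp (⟨E, ε ≫ f.den, ε ≫ f.num, hε.comp hF f.den_mem⟩ : BiratFrac F A B) = divGp f := by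
  haveI : IsIso (Base F ε) := hε.2.2
  haveI : IsIso (Base F f.den) := f.den_mem.2.2
  haveI : IsIso (Base F (ε ≫ f.den)) := (hε.comp hF f.den_mem).2.2
  have hdeg : (degFr F (ε ≫ f.num) : ℕ) = (degFr F f.num : ℕ) := by
    rw [degFr_comp, hε.2.1, one_mul]
  have hinv : inv (Base F (ε ≫ f.den)) = inv (Base F f.den) ≫ inv (Base F ε) :=
    IsIso.inv_eq_of_hom_inv_id (by
      rw [base_comp, Category.assoc, IsIso.hom_inv_id_assoc, IsIso.hom_inv_id])
  have hcancel : ∀ x : Φ.obj (op (baseObj F f.src)),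
      pull Φ (inv (Base F ε)) (pull Φ (Base F ε) x) = x := fun x => by
    rw [← pull_comp, IsIso.inv_hom_id, pull_id]
  unfold divGp deg
  change pullGp Φ (inv (Base F (ε ≫ f.den)))
      (Algebra.GrothendieckGroup.of (Div F (ε ≫ f.num)) /
        Algebra.GrothendieckGroup.of (Div F (ε ≫ f.den)) ^ (degFr F (ε ≫ f.num) : ℕ)) =
    pullGp Φ (inv (Base F f.den))
      (Algebra.GrothendieckGroup.of (Div F f.num) / Algebra.GrothendieckGroup.of (Div F f.den) ^ _)
  rw [hdeg, div_comp, div_comp, f.den_mem.2.1, PNat.one_coe, pow_one, hinv, pullGp_comp]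
  congr 1
  simp only [map_div, map_pow, map_mul, pullGp_of', hcancel]
  rw [mul_pow, mul_div_mul_right_eq_div]

/-- `base` is constant on colimit classes. [cite: MochizukiFrdI2008, Prop. 4.4(i) p.84] -/
theorem base_rel (hF : IsFrobenioid F) {f g : BiratFrac F A B} (h : Rel f g) : base f = base g := by
  obtain ⟨E, ε, ε', hε, hε', hden, hnum⟩ := h
  rw [← base_restrict hF f ε hε, ← base_restrict hF g ε' hε']
  exact (eq_of_eq hden hnum _ _).1

/-- `deg` is constant on colimit classes. [cite: MochizukiFrdI2008, Prop. 4.4(i) p.84] -/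
theorem deg_rel (hF : IsFrobenioid F) {f g : BiratFrac F A B} (h : Rel f g) : deg f = deg g := by
  obtain ⟨E, ε, ε', hε, hε', hden, hnum⟩ := h
  rw [← deg_restrict hF f ε hε, ← deg_restrict hF g ε' hε']
  exact (eq_of_eq hden hnum _ _).2.1

/-- `divGp` is constant on colimit classes. [cite: MochizukiFrdI2008, Prop. 4.4(i) p.84] -/
theorem divGp_rel (hF : IsFrobenioid F) {f g : BiratFrac F A B} (h : Rel f g) :
    divGp f = divGp g := by
  obtain ⟨E, ε, ε', hε, hε', hden, hnum⟩ := h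
  rw [← divGp_restrict hF f ε hε, ← divGp_restrict hF g ε' hε']
  exact (eq_of_eq hden hnum _ _).2.2

/-! ### Remark 1.1.1 for composition by squares -/

/-- Degree of a square's diagonal: `deg_Fr(φ″) = deg_Fr(φ′)` (from `α′ ≫ φ′ = φ″ ≫ β`).
[cite: MochizukiFrdI2008, Rem. 1.1.1] -/
theorem deg_right (f : BiratFrac F A B) (g : BiratFrac F B B') (S : Square f g) :
    degFr F S.right = degFr F f.num := by
  have h := congrArg (degFr F) S.w
  rw [degFr_comp, degFr_comp, S.left_mem.2.1, g.den_mem.2.1, one_mul, mul_one] at h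
  exact h.symm

/-- `deg (g ∘ f) = deg f · deg g`. [cite: MochizukiFrdI2008, Rem. 1.1.1] -/
theorem deg_compWith (hF : IsFrobenioid F) (f : BiratFrac F A B) (g : BiratFrac F B B')
    (S : Square f g) : deg (compWith hF f g S) = deg f * deg g := by
  change degFr F (S.right ≫ g.num) = degFr F f.num * degFr F g.num
  rw [degFr_comp, deg_right f g S]

/-- `Base (g ∘ f) = Base g ∘ Base f`. [cite: MochizukiFrdI2008, Rem. 1.1.1] -/
theorem base_compWith (hF : IsFrobenioid F) (f : BiratFrac F A B) (g : BiratFrac F B B')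
    (S : Square f g) : base (compWith hF f g S) = base f ≫ base g := by
  haveI : IsIso (Base F S.left) := S.left_mem.2.2
  haveI : IsIso (Base F f.den) := f.den_mem.2.2
  haveI : IsIso (Base F g.den) := g.den_mem.2.2
  haveI : IsIso (Base F (S.left ≫ f.den)) := (S.left_mem.comp hF f.den_mem).2.2
  have hw : Base F S.left ≫ Base F f.num = Base F S.right ≫ Base F g.den := by
    rw [← base_comp, S.w, base_comp]
  have hw' : Base F f.num ≫ inv (Base F g.den) = inv (Base F S.left) ≫ Base F S.right := by
    rw [IsIso.comp_inv_eq, Category.assoc, IsIso.eq_inv_comp, hw]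
  have hinv : inv (Base F (S.left ≫ f.den)) = inv (Base F f.den) ≫ inv (Base F S.left) :=
    IsIso.inv_eq_of_hom_inv_id (by
      rw [base_comp, Category.assoc, IsIso.hom_inv_id_assoc, IsIso.hom_inv_id])
  unfold base
  change inv (Base F (S.left ≫ f.den)) ≫ Base F (S.right ≫ g.num) =
    (inv (Base F f.den) ≫ Base F f.num) ≫ inv (Base F g.den) ≫ Base F g.num
  rw [hinv, base_comp, Category.assoc, Category.assoc, ← Category.assoc (Base F f.num), hw',
    Category.assoc]

/-- `Div (g ∘ f) = Base(f)^* Div(g) + deg(g) · Div(f)` in `Φ^gp` (the composition law of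
`F_{Φ^gp}`).
[cite: MochizukiFrdI2008, Rem. 1.1.1] -/
theorem divGp_compWith (hF : IsFrobenioid F) (f : BiratFrac F A B) (g : BiratFrac F B B')
    (S : Square f g) :
    divGp (compWith hF f g S) = pullGp Φ (base f) (divGp g) * divGp f ^ (deg g : ℕ) := by
  haveI : IsIso (Base F S.left) := S.left_mem.2.2
  haveI : IsIso (Base F f.den) := f.den_mem.2.2
  haveI : IsIso (Base F g.den) := g.den_mem.2.2
  haveI : IsIso (Base F (S.left ≫ f.den)) := (S.left_mem.comp hF f.den_mem).2.2
  have hw : Base F S.left ≫ Base F f.num = Base F S.right ≫ Base F g.den := by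
    rw [← base_comp, S.w, base_comp]
  have hw' : Base F f.num ≫ inv (Base F g.den) = inv (Base F S.left) ≫ Base F S.right := by
    rw [IsIso.comp_inv_eq, Category.assoc, IsIso.eq_inv_comp, hw]
  -- the key identity in `Φ(apex)`: `Div(α′ ≫ φ′) = Div(φ″ ≫ β)` expanded (Remark 1.1.1)
  have key : pull Φ (Base F S.right) (Div F g.den) * Div F S.right =
      pull Φ (Base F S.left) (Div F f.num) * Div F S.left ^ (degFr F f.num : ℕ) := by
    have h := congrArg (Div F) S.w
    rw [div_comp, div_comp, g.den_mem.2.1, PNat.one_coe, pow_one] at h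
    exact h.symm
  have hdegR : (degFr F S.right : ℕ) = (degFr F f.num : ℕ) := by rw [deg_right f g S]
  -- transport everything to `Φ^gp(apex)` along the isomorphism `Base(α′ ≫ α)`
  have hinj : Function.Injective (pullGp Φ (Base F (S.left ≫ f.den))) := by
    intro x y hxy
    have := congrArg (pullGp Φ (inv (Base F (S.left ≫ f.den)))) hxy
    rwa [← pullGp_comp, ← pullGp_comp, IsIso.inv_hom_id, pullGp_id, pullGp_id] at this
  apply hinj
  unfold divGp deg base
  change pullGp Φ (Base F (S.left ≫ f.den)) (pullGp Φ (inv (Base F (S.left ≫ f.den)))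
      (Algebra.GrothendieckGroup.of (Div F (S.right ≫ g.num)) /
        Algebra.GrothendieckGroup.of (Div F (S.left ≫ f.den)) ^ (degFr F (S.right ≫ g.num) : ℕ))) =
    pullGp Φ (Base F (S.left ≫ f.den)) (pullGp Φ (inv (Base F f.den) ≫ Base F f.num)
      (pullGp Φ (inv (Base F g.den)) (Algebra.GrothendieckGroup.of (Div F g.num) /
        Algebra.GrothendieckGroup.of (Div F g.den) ^ (degFr F g.num : ℕ))) *
      (pullGp Φ (inv (Base F f.den)) (Algebra.GrothendieckGroup.of (Div F f.num) /
        Algebra.GrothendieckGroup.of (Div F f.den) ^ (degFr F f.num : ℕ))) ^ (degFr F g.num : ℕ))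
  -- simplify the transports
  rw [← pullGp_comp, IsIso.hom_inv_id, pullGp_id, map_mul, map_pow, ← pullGp_comp, ← pullGp_comp,
    ← pullGp_comp, base_comp]
  simp only [Category.assoc, IsIso.hom_inv_id_assoc, IsIso.hom_inv_id, Category.comp_id]
  rw [hw', IsIso.hom_inv_id_assoc]
  -- now both sides are explicit elements of `Φ^gp(apex)`
  rw [map_div, map_pow, pullGp_of', pullGp_of', map_div, map_pow, pullGp_of',
    pullGp_of', div_comp, div_comp, degFr_comp, PNat.mul_coe, f.den_mem.2.1, PNat.one_coe,
    pow_one, hdegR, map_mul, map_mul, map_pow]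
  set a := Algebra.GrothendieckGroup.of (pull Φ (Base F S.right) (Div F g.num)) with ha
  set r := Algebra.GrothendieckGroup.of (M := Φ.obj (op (baseObj F S.apex))) (Div F S.right) with hr
  set b := Algebra.GrothendieckGroup.of (pull Φ (Base F S.left) (Div F f.den)) with hb
  set l := Algebra.GrothendieckGroup.of (M := Φ.obj (op (baseObj F S.apex))) (Div F S.left) with hl
  set c := Algebra.GrothendieckGroup.of (pull Φ (Base F S.right) (Div F g.den)) with hc
  set n := Algebra.GrothendieckGroup.of (pull Φ (Base F S.left) (Div F f.num)) with hn
  have key' : c * r = n * l ^ (degFr F f.num : ℕ) := by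
    have := congrArg (Algebra.GrothendieckGroup.of (M := Φ.obj (op (baseObj F S.apex)))) key
    rw [map_mul, map_mul, map_pow] at this
    exact this
  have key'' : c ^ (degFr F g.num : ℕ) * r ^ (degFr F g.num : ℕ) =
      n ^ (degFr F g.num : ℕ) * l ^ ((degFr F f.num : ℕ) * (degFr F g.num : ℕ)) := by
    rw [← mul_pow, key', mul_pow, ← pow_mul]
  rw [div_pow, div_mul_div_comm, div_eq_div_iff_mul_eq_mul]
  calc a * r ^ (degFr F g.num : ℕ) *
        (c ^ (degFr F g.num : ℕ) * (b ^ (degFr F f.num : ℕ)) ^ (degFr F g.num : ℕ))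
      = a * (b ^ (degFr F f.num : ℕ)) ^ (degFr F g.num : ℕ) *
          (c ^ (degFr F g.num : ℕ) * r ^ (degFr F g.num : ℕ)) := by ac_rfl
    _ = a * (b ^ (degFr F f.num : ℕ)) ^ (degFr F g.num : ℕ) *
          (n ^ (degFr F g.num : ℕ) * l ^ ((degFr F f.num : ℕ) * (degFr F g.num : ℕ))) := by
        rw [key'']
    _ = a * n ^ (degFr F g.num : ℕ) * (b * l) ^ ((degFr F f.num : ℕ) * (degFr F g.num : ℕ)) := by
        rw [mul_pow, ← pow_mul]
        ac_rfl

end BiratFrac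

/-! ### The functor `C^birat → F_{Φ^gp}` -/

namespace Birat

variable (hF hsq) in
/-- **Prop. 4.4 (i)**: the functor `C^birat → F_{Φ^gp}`, `A ↦ Base A`,
`[(α, φ′)] ↦ (Base(α)⁻¹ ≫ Base(φ′), Φ(α)⁻¹{Div φ′ − deg φ′ · Div α}, deg φ′)`.
[cite: MochizukiFrdI2008, Prop. 4.4(i) p.83] -/
noncomputable def toElemGp : Birat F hF hsq ⥤ ElemFrobenioid (monoidGp Φ) where
  obj X := ElemFrobenioid.of (monoidGp Φ) (baseObj F X.out)
  map {X Y} f := Quotient.lift (s := BiratFrac.setoid F hF X.out Y.out)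
    (fun f => ElemFrobenioid.homMk (A := ElemFrobenioid.of (monoidGp Φ) (baseObj F X.out))
      (B := ElemFrobenioid.of (monoidGp Φ) (baseObj F Y.out)) (BiratFrac.base f) (BiratFrac.divGp f)
      (BiratFrac.deg f))
    (fun f g h => ElemFrobenioid.Hom.ext (BiratFrac.base_rel hF h) (BiratFrac.divGp_rel hF h)
      (BiratFrac.deg_rel hF h)) f
  map_id X := by
    apply ElemFrobenioid.Hom.ext
    · change BiratFrac.base (BiratFrac.ofHom hF (𝟙 X.out)) = 𝟙 (baseObj F X.out)
      rw [BiratFrac.base_ofHom, base_id]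
    · change BiratFrac.divGp (BiratFrac.ofHom hF (𝟙 X.out)) = 1
      rw [BiratFrac.divGp_ofHom, div_id, map_one]
    · change BiratFrac.deg (BiratFrac.ofHom hF (𝟙 X.out)) = 1
      exact degFr_id F X.out
  map_comp {X Y Z} f g := by
    obtain ⟨f, rfl⟩ := homMk_surjective f
    obtain ⟨g, rfl⟩ := homMk_surjective g
    apply ElemFrobenioid.Hom.ext
    · exact BiratFrac.base_compWith hF f g _
    · exact BiratFrac.divGp_compWith hF f g _
    · exact BiratFrac.deg_compWith hF f g _

/-- `C^birat → F_{Φ^gp}` on the class of a fraction. [cite: MochizukiFrdI2008, Prop. 4.4(i) p.83] -/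
theorem toElemGp_map_homMk {X Y : Birat F hF hsq} (f : BiratFrac F X.out Y.out) :
    (toElemGp hF hsq).map (homMk f) =
      ElemFrobenioid.homMk (A := ElemFrobenioid.of (monoidGp Φ) (baseObj F X.out))
        (B := ElemFrobenioid.of (monoidGp Φ) (baseObj F Y.out))
        (BiratFrac.base f) (BiratFrac.divGp f) (BiratFrac.deg f) := rfl

variable (hF hsq) in
/-- The base functor `C^birat → D` (through `F_{Φ^gp} → D`). [cite: MochizukiFrdI2008, Prop. 4.4(i)
p.83] -/
noncomputable def baseFunctor : Birat F hF hsq ⥤ D := toElemGp hF hsq ⋙ ElemFrobenioid.baseFunctor _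

variable (hF hsq) in
/-- The functor `C^birat → F_{0_D}` (through `F_{Φ^gp} → F_{0_D}`, induced by `Φ^gp → 0_D`) — the
pre-Frobenioid structure of group-like type of Prop. 4.4 (ii). [cite: MochizukiFrdI2008, Prop.
4.4(ii) p.83] -/
noncomputable def toElemZero : Birat F hF hsq ⥤ ElemFrobenioid (zeroMonoid D) :=
  toElemGp hF hsq ⋙ ElemFrobenioid.mapNatTrans (toZeroMonoid (monoidGp Φ))

end Birat

/-- **Prop. 4.4 (i)**, the square `C → F_Φ → F_{Φ^gp}` = `C → C^birat → F_{Φ^gp}` commutes on the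
nose
(`F_Φ → F_{Φ^gp}` induced by `Φ → Φ^gp`: identity on bases and degrees, `of` on divisors).
[cite: MochizukiFrdI2008, Prop. 4.4(i) p.83] -/
theorem toBirat_comp_toElemGp_map (hF : IsFrobenioid F) (hsq : HasBiratSquares F) {A B : C}
    (φ : A ⟶ B) :
    (toBirat F hF hsq ⋙ Birat.toElemGp hF hsq).map φ =
      ElemFrobenioid.homMk (A := ElemFrobenioid.of (monoidGp Φ) (baseObj F A))
        (B := ElemFrobenioid.of (monoidGp Φ) (baseObj F B))
        (Base F φ) (Algebra.GrothendieckGroup.of (Div F φ)) (degFr F φ) := by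
  change (Birat.toElemGp hF hsq).map (Birat.homMk (BiratFrac.ofHom hF φ)) = _
  rw [Birat.toElemGp_map_homMk, BiratFrac.base_ofHom, BiratFrac.divGp_ofHom]
  rfl

/-- The `Φ^gp`-divisor of the birational automorphism of a rational function is its divisor
`divHom` of `BiratUnitsDiv.lean` (one object, both constructions).
[cite: MochizukiFrdI2008, Prop. 4.4(i) p.84] -/
theorem BiratFrac.divGp_toBiratFrac {A : C} (p : RatFrac F A) :
    BiratFrac.divGp (⟨p.src, p.den, p.num, p.den_mem⟩ : BiratFrac F A A) = RatFrac.div p := by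
  haveI : IsIso (Base F p.den) := p.den_mem.2.2
  haveI : IsIso (Base F p.num) := p.num_mem.2.2
  have hinv : inv (Base F p.num) = inv (Base F p.den) :=
    IsIso.inv_eq_of_hom_inv_id (by
      rw [show Base F p.num = Base F p.den from p.baseEq.symm]
      exact IsIso.hom_inv_id _)
  unfold BiratFrac.divGp BiratFrac.deg RatFrac.div invDiv
  change pullGp Φ (inv (Base F p.den)) (Algebra.GrothendieckGroup.of (Div F p.num) /
      Algebra.GrothendieckGroup.of (Div F p.den) ^ (degFr F p.num : ℕ)) =
    Algebra.GrothendieckGroup.of (pull Φ (inv (Base F p.num)) (Div F p.num)) /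
      Algebra.GrothendieckGroup.of (pull Φ (inv (Base F p.den)) (Div F p.den))
  rw [p.num_mem.2.1, PNat.one_coe, pow_one, map_div, pullGp_of, pullGp_of, hinv]
  rfl

end PreFrobenioid

end Literature.AlgebraicGeometry.Frobenioids
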